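import Literature.Analysis.FluidPDE.LeiZhang2011RegularityLerayHopf
import Literature.Analysis.FluidPDE.LerayHopfClassicalContinuation
import Literature.Analysis.FluidPDE.AxisymmetricNoSwirlGlobal
import Literature.Analysis.FluidPDE.NSCriticalClosureTao
import HarnessLib

/-!
# Lei–Zhang 2011, Theorem 1.4 for smooth data, conditional on the swirl step only

Analysis/FluidPDE **proofs file** (theorems only: no definitions, no named facts, no `sorry`) on
the discharge path of the named fact
`Literature.Analysis.FluidPDE.LeiZhang2011_regularity_bmoStream` (Z. Lei, Q. S. Zhang,
J. Funct. Anal. 261 (2011) = arXiv:1011.5066, **Theorem 1.4**). The printed proof ("By time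
shifting, we assume that the solution `v` exists in the time interval `[−1, 0]` and that `t = 0`
is a blow up time of `v` … by the assumption on initial value and the maximum principle", p. 12)
argues at the *first* blow-up time of a solution smooth from the initial time on. This file
formalizes exactly that reading for Leray–Hopf solutions issued from a **smooth** datum
(divergence free, all derivatives in `L²`, the class of Tao's local theory
`tao2011_smooth_local_existence_holds`): such a solution has a bounded classical representative
on a short slab `[0, ε)` (weak–strong uniqueness `serrin_weak_strong_uniqueness_holds`); the
supremum `β*` of the ends of bounded classical representatives issued from `0` carries one
(`IsClassicalNSSolutionOn.exists_glue_Ico_right`); its slices are axisymmetric down to `t = 0`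
(continuity), `|r v^θ(·, 0)| ≤ C` and the `BMO` stream class transfer to it, so — granted the
swirl step — `LeiZhang2011_regularity_classical_datum_of_swirlStep` (maximum principle
`abs_swirl_le_of_classical` and the blow-up argument) bounds it up to `β*`, and
`exists_classical_extension_of_bounded_rep` (Leray's continuation with bounds) pushes past `β*`;
hence `β* = T` and the representative is smooth on `[0, T] × ℝ³`.

Main results: `LeiZhang2011_regularity_smoothDatum_of_swirlStep` (classical representative on
`[0, T]`) and `LeiZhang2011_regularity_bmoStream_smoothDatum_of_swirlStep` (the shape of the
named fact for smooth data). What separates the latter from the named fact is the swirl step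
(Theorem 1.1 of the paper) and the smoothness of the datum (the fact allows `L²` data with
bounded `r v^θ`, for which the printed proof's maximum principle is not available).

## References

* Z. Lei, Q. S. Zhang, J. Funct. Anal. 261 (2011) = arXiv:1011.5066: Thm. 1.4, Rem. 1.5 and
  proof §4 (arXiv pp. 4, 12–13). [LeiZhang2011]
* J. C. Robinson, J. L. Rodrigo, W. Sadowski, *The Three-Dimensional Navier–Stokes Equations*,
  CUP (2016), Thms. 6.10, 8.17. [RobinsonRodrigoSadowski2016]
* T. Tao, Anal. PDE 6 (2013) = arXiv:1108.1165, Thm. 5.4. [Tao2011]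
-/

noncomputable section

open MeasureTheory Set Function Filter Topology TopologicalSpace Metric
open scoped InnerProductSpace RealInnerProductSpace NNReal

namespace Literature.Analysis.FluidPDE

open Literature.Analysis.FunctionSpaces SereginSverak2009

variable {T : ℝ} {v : ℝ → EuclideanSpace ℝ (Fin 3) → EuclideanSpace ℝ (Fin 3)}

/-! ### The first piece: a bounded classical representative on a short slab -/

/-- **A Leray–Hopf solution from a smooth datum is classical and bounded on a short initial
slab.** For `v` Leray–Hopf on `ℝ³ × [0, T)` (`ν = 1`) from a smooth divergence-free datum
`v 0` with all derivatives in `L²`, there are `ε ∈ (0, T]` and a classical solution `(V, P)` on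
`[0, ε) × ℝ³` with `V 0 = v 0`, `v(t) = V(t)` a.e. for `t ∈ [0, ε)` and `V` bounded there
(Tao's smooth local solution `tao2011_smooth_local_existence_holds`, Leray–Hopf and bounded by
its Sobolev bounds, identified with `v` by `serrin_weak_strong_uniqueness_holds`, `q = r = ∞`).
[cite: Tao2011, Thm. 5.4] -/
theorem exists_classical_Ico_rep_of_smooth_datum (hT : 0 < T) (hLH : IsLerayHopfOn T 1 0 (v 0) v)
    (h0 : ContDiff ℝ (⊤ : ℕ∞) (v 0)) (h0div : VectorCalculus.IsDivFree (v 0))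
    (h0sob : ∀ n : ℕ, ∫⁻ x, ‖iteratedFDeriv ℝ n (v 0) x‖ₑ ^ 2 < ⊤) :
    ∃ ε : ℝ, 0 < ε ∧ ε ≤ T ∧
      ∃ (V : ℝ → EuclideanSpace ℝ (Fin 3) → EuclideanSpace ℝ (Fin 3))
        (P : ℝ → EuclideanSpace ℝ (Fin 3) → ℝ),
        IsClassicalNSSolutionOn (Ico 0 ε) 1 0 V P ∧ V 0 = v 0 ∧
        (∀ t ∈ Ico 0 ε, v t =ᵐ[volume] V t) ∧ ∃ M : ℝ, ∀ t ∈ Ico 0 ε, ∀ x, ‖V t x‖ ≤ M := by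
  obtain ⟨c, hc, htao⟩ := tao2011_smooth_local_existence_holds
  -- the `H¹` size of the datum
  set Atop : ENNReal := (∫⁻ x, ‖v 0 x‖ₑ ^ 2) +
    ∫⁻ x, ENNReal.ofReal (frobeniusNormSq (fderiv ℝ (v 0) x)) with hAtop
  have hAfin : Atop < ⊤ := by
    refine ENNReal.add_lt_top.2 ⟨?_, ?_⟩
    · rw [lintegral_enorm_sq_eq_lintegral_iteratedFDeriv_zero]; exact h0sob 0
    · exact lt_of_le_of_lt (lintegral_frobeniusNormSq_le_three_mul (v 0))
        (ENNReal.mul_lt_top (by simp) (h0sob 1))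
  set A : ℝ := Atop.toReal with hAdef
  have hA0 : 0 ≤ A := ENNReal.toReal_nonneg
  have hAle : Atop ≤ ENNReal.ofReal A := (ENNReal.ofReal_toReal hAfin.ne).ge
  -- the lifespan `ε = min (c/(A²+1)) T`
  set ε : ℝ := min (c / (A ^ 2 + 1)) T with hεdef
  have hε : 0 < ε := lt_min (by positivity) hT
  have hεT : ε ≤ T := min_le_right _ _
  have hεc : A ^ 2 * ε ≤ c * 1 ^ 3 := by
    have h1 : ε ≤ c / (A ^ 2 + 1) := min_le_left _ _
    have h2 : A ^ 2 * (c / (A ^ 2 + 1)) ≤ c := by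
      rw [mul_div_assoc', div_le_iff₀ (by positivity)]; nlinarith [sq_nonneg A]
    nlinarith [mul_le_mul_of_nonneg_left h1 (sq_nonneg A)]
  obtain ⟨V, P, hcl, hV0, hsob, -, hp, hcont⟩ := htao one_pos hε h0 h0div h0sob hA0 hAle hεc
  -- `V` is Leray–Hopf from `v 0` and bounded
  have hLHV : IsLerayHopfOn ε 1 0 (v 0) V := by
    rw [← hV0]; exact isLerayHopfOn_of_hasBoundedSobolevNormsOn hε hcl hsob hp hcont
  obtain ⟨B, hB0, hB⟩ := exists_forall_norm_le_of_hasBoundedSobolevNormsOn hcl hsob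
  have hS : MemLqLp ⊤ ⊤ V (Ioo 0 ε) :=
    memLqLp_top_top_of_forall_norm_le measurableSet_Ioo hB0
      (fun t ht => (hcl.contDiff_velocity ⟨ht.1.le, ht.2.le⟩).continuous)
      fun t ht x => hB t ⟨ht.1.le, ht.2.le⟩ x
  have hmem : MemLp (v 0) 2 volume := hLH.memLp 0 ⟨le_rfl, hT.le⟩
  have hae : ∀ t ∈ Ioc 0 ε, v t =ᵐ[volume] V t :=
    serrin_weak_strong_uniqueness_holds one_pos hε hLHV hmem (q := ⊤) (r := ⊤) (by simp) (by simp)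
      hS (hLH.of_le hεT)
  refine ⟨ε, hε, hεT, V, P, hcl.mono Ico_subset_Icc_self (uniqueDiffOn_Ico 0 ε), hV0, ?_,
    B, fun t ht x => hB t ⟨ht.1, ht.2.le⟩ x⟩
  intro t ht
  rcases ht.1.eq_or_lt with h | h
  · rw [← h, hV0]
  · exact hae t ⟨h, ht.2.le⟩

/-! ### Axisymmetry at the initial time -/

/-- Axisymmetry passes to the initial slice of a field jointly continuous on `[0, β) × ℝ³` whose
positive-time slices are axisymmetric. [folklore] -/
theorem isAxisymmetric_zero_of_continuousOn {β : ℝ} (hβ : 0 < β)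
    {V : ℝ → EuclideanSpace ℝ (Fin 3) → EuclideanSpace ℝ (Fin 3)}
    (hV : ContinuousOn (uncurry V) (Ico 0 β ×ˢ univ)) (haxi : ∀ t ∈ Ioo 0 β, IsAxisymmetric (V t)) :
    IsAxisymmetric (V 0) := by
  intro θ y
  have hcw : ∀ x, ContinuousWithinAt (fun t => V t x) (Ico 0 β) 0 := fun x =>
    (hV.comp (continuousOn_id.prodMk continuousOn_const)
      (fun t ht => ⟨ht, mem_univ x⟩)).continuousWithinAt ⟨le_rfl, hβ⟩
  have h1 : Tendsto (fun t => V t (rotZ θ y)) (𝓝[Ioo 0 β] 0) (𝓝 (V 0 (rotZ θ y))) :=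
    ((hcw (rotZ θ y)).mono Ioo_subset_Ico_self).tendsto
  have h2 : Tendsto (fun t => rotZ θ (V t y)) (𝓝[Ioo 0 β] 0) (𝓝 (rotZ θ (V 0 y))) :=
    ((rotZL θ).continuous.tendsto _).comp ((hcw y).mono Ioo_subset_Ico_self).tendsto
  haveI : (𝓝[Ioo 0 β] (0 : ℝ)).NeBot := by
    rw [← mem_closure_iff_nhdsWithin_neBot, closure_Ioo hβ.ne]
    exact ⟨le_rfl, hβ.le⟩
  refine tendsto_nhds_unique h1 (h2.congr' ?_)
  filter_upwards [self_mem_nhdsWithin] with t ht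
  exact (haxi t ht θ y).symm

/-! ### Theorem 1.4 for smooth data -/

/-- **Lei–Zhang 2011, Theorem 1.4 for Leray–Hopf solutions from smooth data, conditional on the
swirl step.** Let `v` be a Leray–Hopf weak solution of the unforced Navier–Stokes system
(`ν = 1`) on `ℝ³ × [0, T)` from a smooth divergence-free datum `v 0` with all derivatives in `L²`,
with axisymmetric slices on `(0, T)`, `|r v^θ(·, 0)| ≤ C`, and a stream function with `BMO`
slices on `(0, T)`; assume the swirl step (Theorem 1.1 of the paper for the blow-up limit class).
Then `v` has a classical representative `(V, P)` on the closed slab `[0, T] × ℝ³`, `V 0 = v 0`,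
`v(t) = V(t)` a.e. for every `t ∈ [0, T)`. Proof: the supremum `β*` of
`S = {β ≤ T : [0, β) carries a bounded classical representative from v 0}` (nonempty by
`exists_classical_Ico_rep_of_smooth_datum`) carries one (glue); it is axisymmetric down to
`t = 0`, with `|Γ(·, 0)| ≤ C` and the transferred stream functions, so
`LeiZhang2011_regularity_classical_datum_of_swirlStep` bounds it on `[0, β*)`, and
`exists_classical_extension_of_bounded_rep` continues it past `β*` with bounds — beyond `T`,
since otherwise `S` would contain a larger element. [cite: LeiZhang2011, Thm. 1.4, Rem. 1.5 and proof §4 (arXiv pp. 4, 12–13)] -/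
theorem LeiZhang2011_regularity_smoothDatum_of_swirlStep
    (hstep : ∀ (w : ℝ → EuclideanSpace ℝ (Fin 3) → EuclideanSpace ℝ (Fin 3)) (C : ℝ),
      IsBoundedWeakNSSolutionOn (Iio 0) isOpen_Iio 1 w → Continuous (uncurry w) →
      (∀ t < 0, IsAxisymmetric (w t)) → (∀ t < 0, ∀ x, |swirl (w t) x| ≤ C) →
      (∀ t < 0, ∃ Bt : EuclideanSpace ℝ (Fin 3) → EuclideanSpace ℝ (Fin 3),
        LocallyIntegrable Bt volume ∧ eBMOSeminormVec Bt < ⊤ ∧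
        ∀ (φ : EuclideanSpace ℝ (Fin 3) → ℝ) (e : EuclideanSpace ℝ (Fin 3)),
          ContDiff ℝ 1 φ → HasCompactSupport φ →
            ∫ x, φ x * ⟪w t x, e⟫ = ∫ x, ⟪cross (Bt x) (gradient φ x), e⟫) →
      ∀ t < 0, HasNoSwirl (w t))
    (hT : 0 < T) (hLH : IsLerayHopfOn T 1 0 (v 0) v)
    (h0 : ContDiff ℝ (⊤ : ℕ∞) (v 0)) (h0div : VectorCalculus.IsDivFree (v 0))
    (h0sob : ∀ n : ℕ, ∫⁻ x, ‖iteratedFDeriv ℝ n (v 0) x‖ₑ ^ 2 < ⊤)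
    (haxi : ∀ t ∈ Ioo 0 T, IsAxisymmetric (v t)) (hΓ₀ : ∃ C : ℝ, ∀ x, |swirl (v 0) x| ≤ C)
    (hB : ∃ (B : ℝ → EuclideanSpace ℝ (Fin 3) → EuclideanSpace ℝ (Fin 3)) (K : ℝ≥0),
      HasBMOStreamFunctionOn (Ioo 0 T) v B K) :
    ∃ (V : ℝ → EuclideanSpace ℝ (Fin 3) → EuclideanSpace ℝ (Fin 3))
      (P : ℝ → EuclideanSpace ℝ (Fin 3) → ℝ),
      IsClassicalNSSolutionOn (Icc 0 T) 1 0 V P ∧ V 0 = v 0 ∧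
        ∀ t ∈ Ico 0 T, v t =ᵐ[volume] V t := by
  obtain ⟨Bs, Kb, hBs⟩ := hB
  -- the admissible ends
  set S : Set ℝ := {β | 0 < β ∧ β ≤ T ∧
    ∃ (V : ℝ → EuclideanSpace ℝ (Fin 3) → EuclideanSpace ℝ (Fin 3))
      (P : ℝ → EuclideanSpace ℝ (Fin 3) → ℝ),
      IsClassicalNSSolutionOn (Ico 0 β) 1 0 V P ∧ V 0 = v 0 ∧
      (∀ t ∈ Ico 0 β, v t =ᵐ[volume] V t) ∧
      ∀ τ < β, ∃ M : ℝ, ∀ t ∈ Icc 0 τ, ∀ x, ‖V t x‖ ≤ M} with hSdef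
  obtain ⟨ε, hε, hεT, V₁, P₁, hV₁, hV₁0, hrep₁, M₁, hM₁⟩ :=
    exists_classical_Ico_rep_of_smooth_datum hT hLH h0 h0div h0sob
  have hεS : ε ∈ S := ⟨hε, hεT, V₁, P₁, hV₁, hV₁0, hrep₁, fun τ hτ =>
    ⟨M₁, fun t ht x => hM₁ t ⟨ht.1, ht.2.trans_lt hτ⟩ x⟩⟩
  have hSne : S.Nonempty := ⟨ε, hεS⟩
  have hSbdd : BddAbove S := ⟨T, fun β hβ => hβ.2.1⟩
  set βs : ℝ := sSup S with hβsdef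
  have hβsT : βs ≤ T := csSup_le hSne fun β hβ => hβ.2.1
  have hεβs : ε ≤ βs := le_csSup hSbdd hεS
  have hβs : 0 < βs := hε.trans_le hεβs
  -- a sequence in `S` increasing to `βs`, and the glued representative on `[0, βs)`
  have hseq : ∀ n : ℕ, ∃ β ∈ S, βs - 1 / ((n : ℝ) + 1) < β := fun n =>
    exists_lt_of_lt_csSup hSne
      (by rw [hβsdef]; linarith [(by positivity : (0 : ℝ) < 1 / ((n : ℝ) + 1))])
  choose b hbS hblt using hseq
  have hbβ : ∀ n, b n ≤ βs := fun n => le_csSup hSbdd (hbS n)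
  have hb : ∀ t, t < βs → ∃ n, t < b n := by
    intro t ht
    obtain ⟨n, hn⟩ := exists_nat_gt (1 / (βs - t))
    refine ⟨n, lt_of_le_of_lt ?_ (hblt n)⟩
    have hpos : 0 < βs - t := sub_pos.2 ht
    have h1 : 1 / ((n : ℝ) + 1) < βs - t := by
      rw [div_lt_iff₀ (by positivity)]
      rw [div_lt_iff₀ hpos] at hn
      nlinarith
    linarith
  choose Vn Pn hVn hVn0 hrepn hbdn using fun n => (hbS n).2.2
  have hagree : ∀ m n, ∀ t ∈ Ico 0 (min (b m) (b n)), Vn m t = Vn n t := by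
    intro m n t ht
    have htm : t ∈ Ico 0 (b m) := ⟨ht.1, ht.2.trans_le (min_le_left _ _)⟩
    have htn : t ∈ Ico 0 (b n) := ⟨ht.1, ht.2.trans_le (min_le_right _ _)⟩
    exact eq_of_ae_eq_of_continuous ((hVn m).contDiff_velocity htm).continuous
      ((hVn n).contDiff_velocity htn).continuous ((hrepn m t htm).symm.trans (hrepn n t htn))
  obtain ⟨V, P, hV, hVeq⟩ := IsClassicalNSSolutionOn.exists_glue_Ico_right hbβ hb hVn hagree
  have hV0 : V 0 = v 0 := by
    obtain ⟨n, hn⟩ := hb 0 hβs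
    rw [hVeq n 0 ⟨le_rfl, hn⟩, hVn0 n]
  have hrep : ∀ t ∈ Ico 0 βs, v t =ᵐ[volume] V t := by
    intro t ht
    obtain ⟨n, hn⟩ := hb t ht.2
    rw [hVeq n t ⟨ht.1, hn⟩]
    exact hrepn n t ⟨ht.1, hn⟩
  have hbdd : ∀ τ < βs, ∃ M : ℝ, ∀ t ∈ Icc 0 τ, ∀ x, ‖V t x‖ ≤ M := by
    intro τ hτ
    obtain ⟨n, hn⟩ := hb τ hτ
    obtain ⟨M, hM⟩ := hbdn n τ hn
    exact ⟨M, fun t ht x => by rw [hVeq n t ⟨ht.1, ht.2.trans_lt hn⟩]; exact hM t ht x⟩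
  -- the hypotheses of the classical-frame theorem for `V` on `[0, βs)`
  have hmemT : ∀ t ∈ Ioo 0 βs, t ∈ Ioo 0 T := fun t ht => ⟨ht.1, ht.2.trans_le hβsT⟩
  have hVaxi' : ∀ t ∈ Ioo 0 βs, IsAxisymmetric (V t) := fun t ht =>
    (haxi t (hmemT t ht)).of_ae_eq (hrep t ⟨ht.1.le, ht.2⟩)
      (hV.contDiff_velocity ⟨ht.1.le, ht.2⟩).continuous
  have hVaxi : ∀ t ∈ Ico 0 βs, IsAxisymmetric (V t) := by
    intro t ht
    rcases ht.1.eq_or_lt with h | h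
    · rw [← h]
      exact isAxisymmetric_zero_of_continuousOn hβs hV.smooth_velocity.continuousOn hVaxi'
    · exact hVaxi' t ⟨h, ht.2⟩
  have hVΓ₀ : ∃ C : ℝ, ∀ x, |swirl (V 0) x| ≤ C := by rw [hV0]; exact hΓ₀
  have hVB : HasBMOStreamFunctionOn (Ioo 0 βs) V Bs Kb :=
    (hBs.mono fun t ht => hmemT t ht).congr_ae fun t ht => hrep t ⟨ht.1.le, ht.2⟩
  -- the bound up to `βs`
  obtain ⟨M, hM⟩ := LeiZhang2011_regularity_classical_datum_of_swirlStep hstep hβs hV hbdd hVaxi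
    hVΓ₀ ⟨Bs, Kb, hVB⟩
  obtain ⟨M₀, hM₀⟩ := hbdd 0 hβs
  have hMall : ∀ t ∈ Ico 0 βs, ∀ x, ‖V t x‖ ≤ max M M₀ := by
    intro t ht x
    rcases ht.1.eq_or_lt with h | h
    · rw [← h]; exact (hM₀ 0 ⟨le_rfl, le_rfl⟩ x).trans (le_max_right _ _)
    · exact (hM t ⟨h, ht.2⟩ x).trans (le_max_left _ _)
  -- continuation past `βs`: the new end would lie in `S`, so it exceeds `T`
  obtain ⟨b', hb', V', P', hV', hV'0, hrep', hbdd'⟩ :=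
    exists_classical_extension_of_bounded_rep one_pos hLH hβs hβsT hV hrep hMall
  have hTb' : T < b' := by
    by_contra hle
    push Not at hle
    have hmem : b' ∈ S := ⟨hβs.trans hb', hle, V', P', hV', by rw [hV'0, hV0],
      fun t ht => hrep' t ⟨ht.1, lt_min ht.2 (ht.2.trans_le hle)⟩, hbdd'⟩
    exact absurd (le_csSup hSbdd hmem) (not_le.2 hb')
  exact ⟨V', P', hV'.mono (Icc_subset_Ico_right hTb') (uniqueDiffOn_Icc hT), by rw [hV'0, hV0],
    fun t ht => hrep' t ⟨ht.1, lt_min (ht.2.trans hTb') ht.2⟩⟩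

/-- **Lei–Zhang 2011, Theorem 1.4 in the shape of the named fact, for smooth data, conditional
on the swirl step.** For a Leray–Hopf weak solution `v` on `ℝ³ × [0, T)` from a smooth
divergence-free datum `v 0` with all derivatives in `L²`, with axisymmetric slices,
`|r v^θ(·, 0)| ≤ C` and a stream function with `BMO` slices on `(0, T)`: there is `w`, smooth on
`(0, T] × ℝ³` (indeed on `[0, T] × ℝ³`), with `v = w` a.e. on `(0, T) × ℝ³`
(`LeiZhang2011_regularity_smoothDatum_of_swirlStep`; slice-wise a.e. equality upgraded to the slab
by `uncurry_ae_eq_restrict_prod_of_forall_slice_ae_eq`). [cite: LeiZhang2011, Thm. 1.4 (arXiv p. 4) and proof §4 (pp. 12–13)] -/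
theorem LeiZhang2011_regularity_bmoStream_smoothDatum_of_swirlStep
    (hstep : ∀ (w : ℝ → EuclideanSpace ℝ (Fin 3) → EuclideanSpace ℝ (Fin 3)) (C : ℝ),
      IsBoundedWeakNSSolutionOn (Iio 0) isOpen_Iio 1 w → Continuous (uncurry w) →
      (∀ t < 0, IsAxisymmetric (w t)) → (∀ t < 0, ∀ x, |swirl (w t) x| ≤ C) →
      (∀ t < 0, ∃ Bt : EuclideanSpace ℝ (Fin 3) → EuclideanSpace ℝ (Fin 3),
        LocallyIntegrable Bt volume ∧ eBMOSeminormVec Bt < ⊤ ∧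
        ∀ (φ : EuclideanSpace ℝ (Fin 3) → ℝ) (e : EuclideanSpace ℝ (Fin 3)),
          ContDiff ℝ 1 φ → HasCompactSupport φ →
            ∫ x, φ x * ⟪w t x, e⟫ = ∫ x, ⟪cross (Bt x) (gradient φ x), e⟫) →
      ∀ t < 0, HasNoSwirl (w t))
    (hT : 0 < T) (hLH : IsLerayHopfOn T 1 0 (v 0) v)
    (h0 : ContDiff ℝ (⊤ : ℕ∞) (v 0)) (h0div : VectorCalculus.IsDivFree (v 0))
    (h0sob : ∀ n : ℕ, ∫⁻ x, ‖iteratedFDeriv ℝ n (v 0) x‖ₑ ^ 2 < ⊤)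
    (haxi : ∀ t ∈ Ioo 0 T, IsAxisymmetric (v t)) (hΓ₀ : ∃ C : ℝ, ∀ x, |swirl (v 0) x| ≤ C)
    (hB : ∃ (B : ℝ → EuclideanSpace ℝ (Fin 3) → EuclideanSpace ℝ (Fin 3)) (K : ℝ≥0),
      HasBMOStreamFunctionOn (Ioo 0 T) v B K) :
    ∃ w : ℝ → EuclideanSpace ℝ (Fin 3) → EuclideanSpace ℝ (Fin 3),
      IsSmoothSpaceTimeOn (Ioc 0 T) w ∧
        uncurry v =ᵐ[volume.restrict (Ioo 0 T ×ˢ univ)] uncurry w := by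
  obtain ⟨V, P, hV, -, hrep⟩ :=
    LeiZhang2011_regularity_smoothDatum_of_swirlStep hstep hT hLH h0 h0div h0sob haxi hΓ₀ hB
  refine ⟨V, hV.smooth_velocity.mono Ioc_subset_Icc_self, ?_⟩
  refine uncurry_ae_eq_restrict_prod_of_forall_slice_ae_eq measurableSet_Ioo
    (fun t ht => hrep t ⟨ht.1.le, ht.2⟩) hLH.weak.1 ?_
  exact (hV.smooth_velocity.continuousOn.mono (prod_mono Ioo_subset_Icc_self Subset.rfl)
    ).aestronglyMeasurable (measurableSet_Ioo.prod MeasurableSet.univ)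

end Literature.Analysis.FluidPDE
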